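import Literature.NumberTheory.LFunctions.Zhang2022.Section3Lemma34
import Literature.NumberTheory.LFunctions.Zhang2022.RepairGapLemma35ScaleLaw
import Literature.NumberTheory.LFunctions.Zhang2022.RepairGapLemma36ScaleLaw
import HarnessLib

/-!
# Zhang (2022), rescue GAP/REQSIDE (D-0124 (4)–(5)): the SCALE LAW of Proposition 2.1 — under (A) at
# exponent `E ≥ k + 1283` (`k ≤ 740`) the exceptional family has `#Ψ₂ ≪ 𝔓𝓛^{−k}`; the located
# exponent budget's S0 line («only `E` moves») as a theorem about `L`-functions on the sufficiency side

Topic `Literature/NumberTheory/LFunctions/Zhang2022` (Landau–Siegel audit tree; verdict-neutral).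
Y. Zhang, *Discrete mean estimates and the Landau–Siegel zero*, arXiv:2211.02515v1 (2022)
[Zhang2022LandauSiegel] — **an unrefereed manuscript under adjudication; nothing in this file asserts or
denies its Theorems 1–2, and nothing here is a claim about Landau–Siegel zeros. The programme SEARCHES and
TYPES; no claim about Landau–Siegel zeros, Theorems 1–2 of arXiv:2211.02515 or a repaired Margin232 until a
kernel theorem says so.**

Proposition 2.1 (§2 p. 6: "Let `Ψ₂` be the complement of `Ψ₁` in `Ψ`. If (A) holds, then
`∑_{ψ∈Ψ₂} 1 ≪ 𝔓𝓛^{−739}`"; §3 p. 16: "follows from Lemma 3.4, 3.5 and 3.6 immediately") is the tree theorem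
`Skeleton.prop21_holds` (`Section3Prop21`, the union bound `Skeleton.prop21_of_lemmas` over the discharged leaves
`lemma34_holds` / `lemma35_holds` / `lemma36_holds`). The rescue's exponent budget (kit LP-3 j271838; kernel twin
`Repair.Gap.ExpTuple`, file `RepairGapExponentBudget`) is DESK ARITHMETIC on readings of these steps: Lemma 3.1
saving `s₁ = E − 2 − x_P`, Lemma 3.2 saving `s₂ = E − 15`, counts `e₃ = (s₁ − 102) − 2τ₃`, `e₄ = (s₂ − 2) − 2τ₄`,
requirement `e ≥ e_req = 717` ((7.5)), whence `E_min(S0) = 2000` (`ExpTuple.le_of_budgetS0`, `budgetS0_2000`).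
With the scale laws `RepairGapLemma31ScaleLaw` (s₁), `RepairGapLemma35ScaleLaw` (e₃, tree constant `95`),
`RepairGapLemma32FlatScaleLaw` + `RepairGapLemma36ScaleLaw` (s₂, e₄ along the tree's subconvexity-free route)
those readings are theorems; this file composes them with the (A)-free Lemma 3.4 (`Skeleton.lemma34_holds`,
`𝔓𝓛^{−740}`) exactly as `prop21_of_lemmas` does:

* `prop21_scale_of_assumptionAWith` — for natural `k ≤ 740` and real `E ≥ k + 1283`: for all large `D` and every
  real primitive `χ` mod `D`, `AssumptionAWith E D χ → #Ψ₂ ≤ C·𝔓·𝓛^{−k}` (Lemma 3.5 at saving `k + 1265`, premise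
  `k + 1276`; Lemma 3.6 at saving `k + 1268`, premise `k + 1283` — the binding leaf; Lemma 3.4 caps `k ≤ 740`);
* `prop21_rate717_of_assumptionAWith_2000` — the instance `k = 717`, `E = 2000`: the LP's S0 corner
  (`E_min(S0) = 2000` at the (7.5)-requirement `e_req = 717`) on the SUFFICIENCY side, as a theorem.

READING (GAP G-31 / REQSIDE (5), as-typed): along the tree's routes Prop. 2.1 with exponent `k` costs (A) at
exponent `k + 1283` (`k ≤ 740`); the typed node `Skeleton.Prop21` (`k = 739`) costs exactly the printed `2022`,
and the (7.5) requirement `717` costs `2000` = the desk's `E_min(S0)`. This certifies the desk's linear forms as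
SUFFICIENT conditions derived from `L`-function estimates; it does not certify necessity (no lower bounds are
proved), nor the reading `e_req = 717` of (7.5), nor anything about (A). Theorems only; no definition, no named fact.

## References

* Y. Zhang, arXiv:2211.02515v1 (2022), §2 Prop. 2.1 (p. 6), Assumption (A) (p. 4); §3 Lemmas 3.4–3.6 (p. 7, p. 16);
  §7 (7.5). [cite: Zhang2022LandauSiegel, §2 Prop. 2.1; §3 p. 16]
-/

noncomputable section

open Real

namespace Literature.NumberTheory.LFunctions.Zhang2022.Repair.Gap

open Literature.NumberTheory.LFunctions.Zhang2022 (frakP)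
open Literature.NumberTheory.LFunctions.Zhang2022.Skeleton
open Literature.NumberTheory.LFunctions.Zhang2022.Repair.Bed (AssumptionAWith)

/-- **Proposition 2.1 with the exponent free (sufficiency).** For natural `k ≤ 740` and real `E ≥ k + 1283`
there is `C` such that for all large `D` and every real primitive character `χ` mod `D`,
`AssumptionAWith E D χ → #Ψ₂ ≤ C·𝔓·𝓛^{−k}` (`Ψ₂ = Ψ ∖ Ψ₁`, `Skeleton.PsiTwo`; `𝔓 = ∑_{p∼P} p`). The union bound of
`Skeleton.prop21_of_lemmas` over `Skeleton.lemma34_holds` (`𝔓𝓛^{−740}`, no (A)),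
`not_ineq35_count_of_assumptionAWith (k + 1265)` (`𝔓𝓛^{1265}/𝓛^{k+1265}`, premise `E ≥ k + 1276`) and
`not_ineq36_count_of_assumptionAWith (k + 1268)` (`𝔓𝓛^{1268}/𝓛^{k+1268}`, premise `E ≥ k + 1283`). At `k = 739`
this is the typed `Skeleton.Prop21` from `E ≥ 2022` (the printed exponent; not restated).
[cite: Zhang2022LandauSiegel, §2 Prop. 2.1; §3 p. 16] -/
theorem prop21_scale_of_assumptionAWith (k : ℕ) (hk : k ≤ 740) {E : ℝ} (hE : ((k + 1283 : ℕ) : ℝ) ≤ E) :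
    ∃ C : ℝ, ForAllLarge fun D _ χ => AssumptionAWith E D χ →
      ((PsiTwo χ).ncard : ℝ) ≤ C * frakP D * (ell D ^ k)⁻¹ := by
  have hE5 : ((k + 1265 + 11 : ℕ) : ℝ) ≤ E := le_trans (by push_cast; linarith) hE
  have hE6 : ((k + 1268 + 15 : ℕ) : ℝ) ≤ E := le_trans (by push_cast; linarith) hE
  obtain ⟨C₄, h4⟩ := lemma34_holds
  obtain ⟨C₅, h5⟩ := not_ineq35_count_of_assumptionAWith (k + 1265) hE5
  obtain ⟨C₆, h6⟩ := not_ineq36_count_of_assumptionAWith (k + 1268) hE6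
  refine ⟨max C₄ 0 + max C₅ 0 + max C₆ 0, ?_⟩
  obtain ⟨D₀, h⟩ := (h4.and h5).and h6
  refine ⟨max D₀ 3, fun D _ χ hD hq hp hA => ?_⟩
  obtain ⟨⟨h4', h5'⟩, h6'⟩ := h D χ (le_trans (le_max_left _ _) hD) hq hp
  have hD3 : 3 ≤ D := le_trans (le_max_right _ _) hD
  have hℓ : 1 ≤ ell D := by
    have hD' : (3 : ℝ) ≤ D := by exact_mod_cast hD3
    have h3 : (1 : ℝ) < Real.log 3 := by
      rw [Real.lt_log_iff_exp_lt (by norm_num)]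
      exact Real.exp_one_lt_d9.trans (by norm_num)
    exact le_trans h3.le (Real.log_le_log (by norm_num) hD')
  have hℓ0 : 0 < ell D := by linarith
  have hℓne : ell D ≠ 0 := hℓ0.ne'
  have hP : 0 ≤ frakP D := by
    rw [frakP_eq_sum_primeWindow]; exact Finset.sum_nonneg fun p _ => Nat.cast_nonneg p
  set X : ℝ := frakP D * (ell D ^ k)⁻¹ with hX
  have hX0 : 0 ≤ X := by positivity
  have h740 : (ell D ^ 740)⁻¹ ≤ (ell D ^ k)⁻¹ :=
    inv_anti₀ (by positivity) (pow_le_pow_right₀ hℓ hk)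
  have e1265 : ell D ^ 1265 / ell D ^ (k + 1265) = (ell D ^ k)⁻¹ := by
    rw [pow_add]; field_simp
  have e1268 : ell D ^ 1268 / ell D ^ (k + 1268) = (ell D ^ k)⁻¹ := by
    rw [pow_add]; field_simp
  -- the three exceptional sets
  set S₄ : Set (Chr D) := {x | ¬ Ineq34 χ x}
  set S₅ : Set (Chr D) := {x | ¬ Ineq35 χ x}
  set S₆ : Set (Chr D) := {x | ¬ Ineq36 χ x}
  have hsub : PsiTwo χ ⊆ (S₄ ∪ S₅) ∪ S₆ := by
    intro x hx
    simp only [PsiTwo, PsiOne, Set.mem_compl_iff, Set.mem_setOf_eq, not_and_or] at hx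
    simp only [S₄, S₅, S₆, Set.mem_union, Set.mem_setOf_eq]
    tauto
  have hcard : (PsiTwo χ).ncard ≤ S₄.ncard + S₅.ncard + S₆.ncard :=
    (Set.ncard_le_ncard hsub (Set.toFinite _)).trans
      ((Set.ncard_union_le _ _).trans (by gcongr; exact Set.ncard_union_le _ _))
  have e4 : (S₄.ncard : ℝ) ≤ max C₄ 0 * X := by
    calc (S₄.ncard : ℝ) ≤ C₄ * frakP D * (ell D ^ 740)⁻¹ := h4'
      _ ≤ max C₄ 0 * frakP D * (ell D ^ 740)⁻¹ := by gcongr; exact le_max_left _ _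
      _ ≤ max C₄ 0 * frakP D * (ell D ^ k)⁻¹ := by gcongr
      _ = max C₄ 0 * X := by rw [hX]; ring
  have e5 : (S₅.ncard : ℝ) ≤ max C₅ 0 * X := by
    calc (S₅.ncard : ℝ) ≤ C₅ * frakP D * ell D ^ 1265 / ell D ^ (k + 1265) := h5' hA
      _ = C₅ * frakP D * (ell D ^ 1265 / ell D ^ (k + 1265)) := by ring
      _ = C₅ * X := by rw [e1265, hX]; ring
      _ ≤ max C₅ 0 * X := by gcongr; exact le_max_left _ _
  have e6 : (S₆.ncard : ℝ) ≤ max C₆ 0 * X := by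
    calc (S₆.ncard : ℝ) ≤ C₆ * frakP D * ell D ^ 1268 / ell D ^ (k + 1268) := h6' hA
      _ = C₆ * frakP D * (ell D ^ 1268 / ell D ^ (k + 1268)) := by ring
      _ = C₆ * X := by rw [e1268, hX]; ring
      _ ≤ max C₆ 0 * X := by gcongr; exact le_max_left _ _
  calc ((PsiTwo χ).ncard : ℝ) ≤ (S₄.ncard : ℝ) + S₅.ncard + S₆.ncard := by exact_mod_cast hcard
    _ ≤ max C₄ 0 * X + max C₅ 0 * X + max C₆ 0 * X := by linarith
    _ = (max C₄ 0 + max C₅ 0 + max C₆ 0) * frakP D * (ell D ^ k)⁻¹ := by rw [hX]; ring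

/-- **The S0 corner of the located exponent budget as a theorem (sufficiency side)**: (A) at exponent `2000`
gives Proposition 2.1 with exponent `717` — `AssumptionAWith 2000 D χ → #Ψ₂ ≤ C·𝔓·𝓛^{−717}` for all large `D`
(`2000 = 717 + 1283`; `717` is the desk reading `ExpTuple.eReq` of what (7.5) requires of Prop. 2.1, and `2000`
the desk's `E_min(S0)`, `ExpTuple.budgetS0_2000`; whether `717` suffices downstream is the desk's reading of
(7.5), not certified here). [cite: Zhang2022LandauSiegel, §2 Prop. 2.1; §7 (7.5)] -/
theorem prop21_rate717_of_assumptionAWith_2000 :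
    ∃ C : ℝ, ForAllLarge fun D _ χ => AssumptionAWith 2000 D χ →
      ((PsiTwo χ).ncard : ℝ) ≤ C * frakP D * (ell D ^ 717)⁻¹ :=
  prop21_scale_of_assumptionAWith 717 (by norm_num) (by norm_num)

end Literature.NumberTheory.LFunctions.Zhang2022.Repair.Gap

end
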